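import Mathlib
import Summits.Ventures.PercRepro2.SwOutCoreShadowKind
import Summits.Ventures.PercRepro2.SwOutJunctionH1GTypedCubes
import Summits.Ventures.PercRepro2.SwOutJunctionH1GTypedSides

/-!
# The (H1) single junction on the general doubly typed side, II: the shadow kind (blind cell
PercRepro2, night-4 g33, 2026-08-28; proofs/NIGHT4-G33.md §3)

g14's shadow kind (SwOutCoreShadowKey, SwOutCoreShadowKind) for g7's general doubly typed side:
a side point of a shadow block is escaping (`not_hull_u_subset_of_mem_shadowBlock_g` — a dropped
vertex that is not exempt escapes through its outside edge; an EXEMPT dropped vertex lies in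
`C_R(l)`, so at the X-red points its red cluster, which stays in the dropped arms, would carry `l`
into the extended hull, and at the X-blue points the red edge `u–z` puts `l` in the red cluster of
`u` — g14's argument for the mark `o` verbatim), the constancy of the key along a shadow block
(`shadowKind_of_mem_shadowBlock_g`) and the rigid inequality on a shadow block
(`shadowBlock_card_le_g`, from `card_shadowCube_le_g`; the vertices of `X` avoid the extended hull
of the base).
-/

namespace Summit.Ventures.PercRepro2

namespace LocRows

open Hull

variable {V : Type*} {E : Type*} [Fintype E] [DecidableEq E]

open scoped Classical

variable {ends : E → Sym2 V} {U : Set V} {ξ : Config E} {l h u : V} {b : Config E}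
  {S R : Finset (Set V)} {𝓤 𝓓 𝓓'' : Set (Set V)} {X : Set V} {𝓤' : Set (Set V)} {F : V → Prop}

section Escaping

variable (hl : l ∉ U) (hF : ∀ x, F x → ∀ S ∈ 𝓤, x ∈ S)
  (hout : ∀ x ∈ U, x ≠ h → x ≠ u →
    F x ∨ x ∈ X ∨ (∃ e y, ends e = s(x, y) ∧ y ∉ U) ∨ (∀ e, x ∉ ends e))
  (hhX : h ∉ X) (huX : u ∉ X) (hX : ∀ x ∈ X, x ∈ U → ∀ e, x ∈ ends e → ends e = s(x, x))
  (hHU : extHull ends b h u ⊆ U)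
  (hb : CoreBase ends b h u (extHull ends b h u) (armsFun S) (pureFun ends h S))
  (huR : uRed ends (armsFun S) u (pureFun ends h S) (omegaSR S R))
  (huB : ¬ uRed ends (armsFun S) u (pureFun ends h S) (flipAll (omegaSR S R)))

include hb huR huB hl hF hout hhX huX hX hHU in
/-- **A side point of a shadow block is escaping**: the hull of `u` leaves `U` (a dropped vertex
that is not exempt escapes through its outside edge; an exempt dropped vertex lies in `C_R(l)`,
which excludes the X-red points and escapes through `l` at the X-blue points). -/
theorem not_hull_u_subset_of_mem_shadowBlock_g
    (hZ : ∃ P : S, uAdjC ends u (armsFun S) P ∧ omegaSR S R P = false) {ζ' : Config E}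
    (hζ' : ζ' ∈ shadowBlock ends u b S R) (hQ : ζ' ∈ gTypedQ ends l h 𝓤 𝓓 𝓓'' X 𝓤') :
    ¬ hull ends ζ' u ⊆ U := by
  obtain ⟨ω', rfl⟩ := (mem_shadowBlock_iff).1 hζ'
  obtain ⟨P, ⟨e, z, huz, hzP⟩, hωP⟩ := hZ
  have hz : z ∈ sZ ends u (armsFun S) (omegaSR S R) := ⟨P, ⟨e, z, huz, hzP⟩, hωP, hzP⟩
  have hzH : z ∈ extHull ends b h u := (hb.arm_sub P z hzP).1
  have hzh : z ≠ h := (hb.arm_sub P z hzP).2.1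
  have hzu : z ≠ u := (hb.arm_sub P z hzP).2.2
  have h1 := hb.shadowReal_uZ huR huB ω' hz huz
  intro hsub
  by_cases hzF : F z
  · -- the dropped vertex is exempt: it lies in `C_R(l)`
    have hoA : z ∈ cluster ends (shadowReal ends (sB ends u (armsFun S) (omegaSR S R))
        (sZ ends u (armsFun S) (omegaSR S R)) none (shadowOf ends u (armsFun S) (omegaSR S R) b)
        ω') l := hF z hzF _ (mem_gTypedQ.1 hQ).2.1
    cases hn : ω' none with
    | true =>
      -- the red cluster of `o` stays in the dropped arms, which avoid `l`
      have hlo := conn_symm hoA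
      have := hb.cluster_subset_sZ_of_none_true huR huB ω' hn hz hlo
      obtain ⟨P', _, _, hlP'⟩ := this
      exact hl (hHU (hb.arm_sub P' l hlP').1)
    | false =>
      -- the edge `u z` is red: `l` is in the red cluster of `u`
      rw [hn] at h1
      have hred : shadowReal ends (sB ends u (armsFun S) (omegaSR S R))
          (sZ ends u (armsFun S) (omegaSR S R)) none (shadowOf ends u (armsFun S) (omegaSR S R) b)
          ω' e = true := by rw [h1]; rfl
      have hu := mem_cluster_of_edge hoA hred (ends_swap huz)
      exact hl (hsub (Or.inl (conn_symm hu)))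
  · -- a dropped vertex that is not exempt carries an outside edge
    rcases hout z (hHU hzH) hzh hzu with hf | hzX | ⟨e', y, hzy, hyU⟩ | hiso
    · exact absurd hf hzF
    · exact absurd hzH (notMem_extHull_of_mem_X hhX huX hX hHU hzX)
    · have hyH : y ∉ extHull ends b h u := fun hyH => hyU (hHU hyH)
      have h2 := hb.shadowReal_Z_out huR huB ω' hz hzy hyH
      cases hn : ω' none with
      | true =>
        rw [hn] at h1 h2
        have hb1 : blue (shadowReal ends (sB ends u (armsFun S) (omegaSR S R))
            (sZ ends u (armsFun S) (omegaSR S R)) none (shadowOf ends u (armsFun S) (omegaSR S R) b)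
            ω') e = true := by rw [blue_apply, h1]; rfl
        have hb2 : blue (shadowReal ends (sB ends u (armsFun S) (omegaSR S R))
            (sZ ends u (armsFun S) (omegaSR S R)) none (shadowOf ends u (armsFun S) (omegaSR S R) b)
            ω') e' = true := by rw [blue_apply, h2]; rfl
        have hz' := mem_cluster_of_edge (mem_cluster_self ends _ u) hb1 huz
        exact hyU (hsub (Or.inr (mem_cluster_of_edge hz' hb2 hzy)))
      | false =>
        rw [hn] at h1 h2
        have hr1 : shadowReal ends (sB ends u (armsFun S) (omegaSR S R))
            (sZ ends u (armsFun S) (omegaSR S R)) none (shadowOf ends u (armsFun S) (omegaSR S R) b)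
            ω' e = true := by rw [h1]; rfl
        have hr2 : shadowReal ends (sB ends u (armsFun S) (omegaSR S R))
            (sZ ends u (armsFun S) (omegaSR S R)) none (shadowOf ends u (armsFun S) (omegaSR S R) b)
            ω' e' = true := by rw [h2]; rfl
        have hz' := mem_cluster_of_edge (mem_cluster_self ends _ u) hr1 huz
        exact hyU (hsub (Or.inl (mem_cluster_of_edge hz' hr2 hzy)))
    · exact hiso e (by rw [huz]; exact Sym2.mem_mk_right u z)

end Escaping

section Kind

/-- **The constancy of the key along a shadow block, general doubly typed side**: a side point of
the shadow block of a key with shadow data is of the shadow kind with that key, lies in the side,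
and is escaping. -/
theorem shadowKind_of_mem_shadowBlock_g (hl : l ∉ U) (hF : ∀ x, F x → ∀ S ∈ 𝓤, x ∈ S)
    (hout : ∀ x ∈ U, x ≠ h → x ≠ u →
      F x ∨ x ∈ X ∨ (∃ e y, ends e = s(x, y) ∧ y ∉ U) ∨ (∀ e, x ∉ ends e))
    (hhX : h ∉ X) (huX : u ∉ X) (hX : ∀ x ∈ X, x ∈ U → ∀ e, x ∈ ends e → ends e = s(x, x))
    (hd : ShadowData ends U ξ h u b S R) {ζ' : Config E} (hζ' : ζ' ∈ shadowBlock ends u b S R)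
    (hQ : ζ' ∈ gTypedQ ends l h 𝓤 𝓓 𝓓'' X 𝓤') :
    baseOf ends h u ζ' = b ∧ armsOf ends h u ζ' = S ∧ redOf ends h u ζ' = R ∧
      ShadowKind ends U ξ h u ζ' ∧ ζ' ∈ gOutSide ends l h 𝓤 𝓓 𝓓'' X 𝓤' U ξ ∧
      u ∈ hull ends ζ' h ∧ ¬ hull ends ζ' u ⊆ U := by
  have h1 := baseOf_of_mem_shadowBlock hd.hS hd.hb hd.huR hd.huB hζ'
  have h2 := armsOf_of_mem_shadowBlock hd.hS hd.hb hd.huR hd.huB hζ'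
  have h3 : redOf ends h u ζ' = R := by
    rw [redOf_of_mem_shadowBlock hd.hS hd.hb hd.huR hd.huB hζ', ← hd.hR]
  refine ⟨h1, h2, h3, ⟨by rw [h1, h2, h3]; exact hd, by rw [h1, h2, h3]; exact hζ'⟩, ?_,
    u_mem_hull_of_mem_shadowBlock hd.hb hd.huR hd.huB hζ',
    not_hull_u_subset_of_mem_shadowBlock_g hl hF hout hhX huX hX hd.hHU hd.hb hd.huR hd.huB hd.hZ hζ'
      hQ⟩
  exact mem_gOutSide.2 ⟨hQ, mem_outClass_of_mem_shadowBlock hd.hHU hd.hb hd.huR hd.huB hd.hbcl hζ'⟩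

/-- **The rigid inequality on a shadow block, general doubly typed side** (the vertices of `X`
outside the extended hull of the base). -/
theorem shadowBlock_card_le_g (h𝓤 : IsUpperSet 𝓤) (h𝓓 : IsLowerSet 𝓓) (h𝓓'' : IsLowerSet 𝓓'')
    (h𝓤' : IsUpperSet 𝓤') (hl : l ∉ U) (hHU : extHull ends b h u ⊆ U)
    (hb : CoreBase ends b h u (extHull ends b h u) (armsFun S) (pureFun ends h S))
    (huR : uRed ends (armsFun S) u (pureFun ends h S) (omegaSR S R))
    (huB : ¬ uRed ends (armsFun S) u (pureFun ends h S) (flipAll (omegaSR S R)))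
    (hX : ∀ x ∈ X, x ∉ extHull ends b h u) {𝓔 : Set (Set E)} (h𝓔 : IsUpperSet 𝓔) :
    ((shadowBlock ends u b S R).filter fun ζ' =>
        ζ' ∈ gTypedQ ends l h 𝓤 𝓓 𝓓'' X 𝓤' ∧ redEdges ends ζ' h ∈ 𝓔).card ≤
      ((shadowBlock ends u b S R).filter fun ζ' =>
        ζ' ∈ gTypedQ ends l h 𝓤 𝓓 𝓓'' X 𝓤' ∧ blueEdges ends ζ' h ∈ 𝓔).card := by
  refine (hb.shadowBase huR huB).card_shadowCube_le_g h𝓤 h𝓓 h𝓓'' h𝓤' ?_ ?_ h𝓔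
  · rw [hb.shadow_region_eq]
    exact fun h' => hl (hHU h')
  · intro x hx
    rw [hb.shadow_region_eq]
    exact hX x hx

end Kind

end LocRows

end Summit.Ventures.PercRepro2
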